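import Mathlib
import Literature.NumberTheory.Transcendental.PeriodsWave0
import Literature.NumberTheory.Transcendental.BallRivoalLinearForms
import HarnessLib

/-!
# Cresson–Fischler–Rivoal: the well-poised symmetry ⇒ only odd zeta values (Théorèmes 1 and 2)

Topic `Literature/NumberTheory/Irrationality/CressonFischlerRivoal2008`. Typed, cited statements from
J. Cresson, S. Fischler, T. Rivoal, *Phénomènes de symétrie dans des formes linéaires en
polyzêtas*, J. reine angew. Math. **617** (2008) 109–151 = arXiv:math/0609744 [CressonFischlerRivoal2008],
§1 (read on the page):

* « **Théorème 1.** Soit `P ∈ ℚ[X]` de degré au plus `A(n+1)−2`, tel que `P(−n−X) = (−1)^{A(n+1)+1} P(X)`.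
  Alors la série `Σ_{k≥1} P(k)/(k)_{n+1}^A` est une combinaison linéaire, à coefficients rationnels, de 1 et
  des valeurs `ζ(s)` pour `s` entier impair compris entre 3 et `A`. » (the symmetry property of (very)
  well-poised series, [BR], [RivoalCRAS]; `(k)_{n+1} = k(k+1)⋯(k+n)`);
* « **Théorème 2.** Soient `p ≥ 1`, `n ≥ 0` et `A ≥ 1` des entiers. Soit `P ∈ ℚ[X₁,…,X_p]` un polynôme de
  degré `≤ A(n+1)−2` par rapport à chacune des variables, tel que
  `P(X₁,…,−X_j−n,…,X_p) = (−1)^{A(n+1)+1} P(X₁,…,X_p)` pour tout `j`. Alors la somme multiple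
  `Σ_{k₁,…,k_p ≥ 1} P(k₁,…,k_p)/((k₁)_{n+1}^A⋯(k_p)_{n+1}^A)` est un polynôme à coefficients rationnels,
  de degré au plus `p`, en les `ζ(s)`, pour `s` entier impair compris entre 3 et `A`. »

**Théorème 1 is PROVED** at the end of the file (`theoreme1_holds`, the discharge of the named fact
`theoreme1`), by the argument the source cites for it ([BR] = Ball–Rivoal, Rivoal C. R. Acad. Sci. 2000):
partial fractions, order at infinity, the reflection `k ↦ -n-k`, summation — reusing the tree's machinery
`Literature/NumberTheory/Transcendental/BallRivoal{Bricks,Series,LinearForms}.lean`. **Théorème 2 is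
PROVED** too (`theoreme2_holds`), by reduction to Théorème 1: after the shift `X_j = Y_j − n/2` the symmetry
is `Y_j ↦ −Y_j`, so `P` is a `ℚ`-combination of products `∏_j (X_j + n/2)^{m_j}` whose factors satisfy the
hypotheses of Théorème 1; products of the resulting absolutely convergent series give the polynomial in the
odd zeta values.

Why the cell (pub-zeta5; HONEST FRAMING: systematic search; no irrationality claim unless certified)
wants them: these are the printed IDENTICAL-VANISHING mechanisms ("H = 0" in the census' STRUCTURE.md
§IMPLICATIONS (ii)) — the parasitic even zeta values vanish for every admissible `P`, by a theorem, not
by tuning. Théorème 3 (depth 2, antisymmetric double zetas) and Théorème 4 are not typed here.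

Rendering: `P` a `Polynomial ℚ` (resp. `MvPolynomial (Fin p) ℚ`), the Pochhammer symbol as the finite
product `∏_{j=0}^{n} (k+j)`, the series as a real `tsum` (absolutely convergent under the degree bound —
part of the printed conclusion "la série est …"), `ζ(s) = zetaValue s`; "linear combination of 1 and odd
`ζ(s)`, `3 ≤ s ≤ A`" as `∃ a : ℕ → ℚ, … = a 0 + Σ_{s ∈ [3,A], s odd} a s ζ(s)`; "polynomial of degree ≤ p in
the odd `ζ(s)`" as an `MvPolynomial ℕ ℚ` supported on odd `s ∈ [3,A]` with `totalDegree ≤ p`, evaluated at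
`s ↦ ζ(s)`.
-/

noncomputable section

namespace Literature.NumberTheory.Irrationality.CressonFischlerRivoal2008

open Literature.NumberTheory.Transcendental (zetaValue)

/-- The Pochhammer symbol `(k)_{n+1} = k(k+1)⋯(k+n)` as a real number. [cite: CressonFischlerRivoal2008, §1 (notation after eq. (1.1))] -/
def poch (k n : ℕ) : ℝ := ∏ j ∈ Finset.range (n + 1), ((k : ℝ) + j)

/-- **Théorème 1** of [CressonFischlerRivoal2008] (named fact, statement only): for integers `n ≥ 0`,
`A ≥ 1` and `P ∈ ℚ[X]` with `deg P ≤ A(n+1) − 2` and `P(−n−X) = (−1)^{A(n+1)+1} P(X)`, the series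
`Σ_{k≥1} P(k)/(k)_{n+1}^A` converges to `a₀ + Σ_{3 ≤ s ≤ A, s odd} a_s ζ(s)` for some rationals `a_s`.
[cite: CressonFischlerRivoal2008, Théorème 1] -/
def theoreme1 : Prop :=
  ∀ (n A : ℕ) (P : Polynomial ℚ), 1 ≤ A → P.natDegree + 2 ≤ A * (n + 1) →
    P.comp (-(n : Polynomial ℚ) - Polynomial.X) = (-1 : Polynomial ℚ) ^ (A * (n + 1) + 1) * P →
    ∃ a : ℕ → ℚ,
      HasSum (fun k : ℕ => (Polynomial.aeval ((k : ℝ) + 1) P) / poch (k + 1) n ^ A)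
        ((a 0 : ℝ) + ∑ s ∈ (Finset.Icc 3 A).filter Odd, (a s : ℝ) * zetaValue s)

/-- **Théorème 2** of [CressonFischlerRivoal2008] (named fact, statement only): for `p ≥ 1`, `n ≥ 0`,
`A ≥ 1` and `P ∈ ℚ[X₁,…,X_p]` of degree `≤ A(n+1)−2` in each variable with
`P(…,−X_j−n,…) = (−1)^{A(n+1)+1} P` for every `j`, the decoupled multiple sum
`Σ_{k₁,…,k_p ≥ 1} P(k)/∏_j (k_j)_{n+1}^A` converges to the value at `s ↦ ζ(s)` of a polynomial with rational
coefficients, of total degree `≤ p`, in the variables `ζ(s)`, `s` odd, `3 ≤ s ≤ A`.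
[cite: CressonFischlerRivoal2008, Théorème 2] -/
def theoreme2 : Prop :=
  ∀ (p n A : ℕ) (P : MvPolynomial (Fin p) ℚ), 1 ≤ p → 1 ≤ A →
    (∀ j : Fin p, P.degreeOf j + 2 ≤ A * (n + 1)) →
    (∀ j : Fin p,
      MvPolynomial.aeval (fun i : Fin p =>
          if i = j then -(n : MvPolynomial (Fin p) ℚ) - MvPolynomial.X j else MvPolynomial.X i) P =
        (-1 : MvPolynomial (Fin p) ℚ) ^ (A * (n + 1) + 1) * P) →
    ∃ F : MvPolynomial ℕ ℚ,
      F.totalDegree ≤ p ∧ (∀ s ∈ F.vars, Odd s ∧ 3 ≤ s ∧ s ≤ A) ∧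
      HasSum (fun k : Fin p → ℕ =>
          (MvPolynomial.aeval (fun j => ((k j : ℝ) + 1)) P) / ∏ j, poch (k j + 1) n ^ A)
        (MvPolynomial.aeval (fun s : ℕ => zetaValue s) F)

open Finset Filter Topology Polynomial
open Literature.NumberTheory.Transcendental
open Literature.NumberTheory.Transcendental.BallRivoal hiding poch

/-! ### Proof of Théorème 1

The proof printed in [CressonFischlerRivoal2008, §1] refers to [BR] = Ball–Rivoal and to Rivoal's note
(C. R. Acad. Sci. 331 (2000)); we follow exactly that argument, reusing the partial-fraction machinery
of `Literature/NumberTheory/Transcendental/BallRivoal{Bricks,Series,LinearForms}.lean` (written there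
for Rivoal's special rational function `R_n`): (a) `P(t+1)/(t+1)_{n+1}^A` has partial-fraction data
`c_{o,p}` (poles `-1,…,-(n+1)`, orders `≤ A`); (b) `∑_p c_{0,p} = 0` because `t·P(t+1)/(t+1)_{n+1}^A → 0`
(`deg P ≤ A(n+1)-2`); (c) the hypothesis `P(-n-X) = (-1)^{A(n+1)+1}P(X)` gives
`F(-t-n-2) = -F(t)` for `F(t) = P(t+1)/(t+1)_{n+1}^A`, hence by uniqueness of partial fractions
`(-1)^{o+1} c_{o,n-p} + c_{o,p} = 0`, so `∑_p c_{o,p} = 0` for odd `o` (the even zeta values `ζ(o+1)`);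
(d) summing the expansion over `k ≥ 0` gives `∑_{o ≥ 1} (∑_p c_{o,p}) ζ(o+1) - ∑_{o,p} c_{o,p} H_p^{(o+1)}`. -/

/-- `(t+1)_{n+1} ≠ 0` away from the poles. [folklore] -/
private theorem poch_succ_ne_zero (n : ℕ) (t : ℚ) (ht : ∀ p, p ≤ n → t + p + 1 ≠ 0) :
    BallRivoal.poch (t + 1) (n + 1) ≠ 0 := by
  unfold BallRivoal.poch
  exact prod_ne_zero_iff.2 fun s hs h =>
    ht s (Nat.lt_succ_iff.1 (mem_range.1 hs)) (by linarith)

/-- Data with `K` orders, padded by a zero top order, evaluate the same. [folklore] -/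
private theorem pfEval_extend (n K : ℕ) (c : ℕ → ℕ → ℚ) (t : ℚ) :
    pfEval n (K + 1) (fun o p => if o < K then c o p else 0) t = pfEval n K c t := by
  unfold pfEval
  refine sum_congr rfl fun p _ => ?_
  rw [sum_range_succ]
  have h1 : (fun o p => if o < K then c o p else 0) K p = 0 := by simp
  rw [h1, zero_div, add_zero]
  exact sum_congr rfl fun o ho => by
    have : o < K := mem_range.1 ho
    simp [this]

/-- The brick with the single residue `1` at `m`: `1/(t+m+1)`. [folklore] -/
private theorem brickEval_indicator (n m : ℕ) (hm : m ≤ n) (t : ℚ) :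
    brickEval n (fun m' => if m' = m then (1 : ℤ) else 0) t = 1 / (t + m + 1) := by
  unfold brickEval
  rw [sum_eq_single_of_mem m (mem_range.2 (Nat.lt_succ_of_le hm))]
  · simp
  · intro m' _ hm'
    simp [hm']

/-- `1/(t+m+1) · (1/(t+1)_{n+1})^A` has partial-fraction data with `A+1` orders (a product of `A+1`
bricks, `BallRivoal.exists_pf_prod`). [folklore] -/
private theorem exists_pf_pole_mul_pow (n A m : ℕ) (hm : m ≤ n) :
    ∃ c : ℕ → ℕ → ℚ, ∀ t : ℚ, (∀ p, p ≤ n → t + p + 1 ≠ 0) →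
      pfEval n (A + 1) c t = 1 / (t + m + 1) * (1 / BallRivoal.poch (t + 1) (n + 1)) ^ A := by
  have hdiv : ∀ k : ℕ, 1 ≤ k → k ≤ n → (k : ℤ) ∣ (n.factorial : ℕ) := fun k hk hkn =>
    Int.natCast_dvd_natCast.2 (Nat.dvd_factorial hk hkn)
  obtain ⟨c₀, hc₀, -, -⟩ := exists_pf_prod n n.factorial hdiv
    (fun s => if s = 0 then (fun m' => if m' = m then (1 : ℤ) else 0) else resH n) (A + 1)
    (Nat.succ_pos A)
  refine ⟨fun o p => (1 / (n.factorial : ℚ) ^ A) * c₀ o p, fun t ht => ?_⟩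
  have hpoch := poch_succ_ne_zero n t ht
  have hf : (n.factorial : ℚ) ≠ 0 := by positivity
  rw [pfEval_const_mul, hc₀ t ht, prod_range_succ']
  simp only [Nat.add_one_ne_zero, if_false, if_true]
  have hH : ∀ s ∈ range A, brickEval n (resH n) t =
      (n.factorial : ℚ) / BallRivoal.poch (t + 1) (n + 1) := fun s _ => (H_eq_brickEval n t ht).symm
  rw [prod_congr rfl hH, prod_const, card_range, brickEval_indicator n m hm t]
  rw [div_pow, div_pow, one_pow]
  field_simp

/-- Partial fractions of `Q(t)/(t+1)_{n+1}^A` for `deg Q < A(n+1)` (induction on `A` by Euclidean division by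
the monic `(X+1)_{n+1}` and Lagrange division of the remainder). [folklore] -/
private theorem exists_pf (n : ℕ) : ∀ (A : ℕ), 1 ≤ A → ∀ (Q : ℚ[X]),
    Q.degree < ((A * (n + 1) : ℕ) : WithBot ℕ) →
    ∃ c : ℕ → ℕ → ℚ, ∀ t : ℚ, (∀ p, p ≤ n → t + p + 1 ≠ 0) →
      pfEval n A c t = Q.eval t / BallRivoal.poch (t + 1) (n + 1) ^ A := by
  intro A hA
  induction A, hA using Nat.le_induction with
  | base =>
    intro Q hQ
    rw [one_mul] at hQ
    refine ⟨fun o p => if o = 0 then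
      Q.eval (-(p : ℚ) - 1) * ((-1) ^ p / ((p.factorial : ℚ) * (n - p).factorial)) else 0,
      fun t ht => ?_⟩
    rw [pow_one, lagrange_div n Q hQ t ht, pfEval]
    refine sum_congr rfl fun p _ => ?_
    rw [sum_range_one, if_pos rfl, zero_add, pow_one]
  | succ A hA ih =>
    intro Q hQ
    set D : ℚ[X] := pochPoly 1 (n + 1) with hD
    have hDm : D.Monic := by
      rw [hD, pochPoly]
      exact monic_prod_of_monic _ _ fun s _ => monic_X_add_C _
    have hDn : D.natDegree = n + 1 := by
      rw [hD, pochPoly, natDegree_prod_of_monic _ _ fun s _ => monic_X_add_C _,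
        Finset.sum_congr rfl fun s _ => natDegree_X_add_C _]
      simp
    have hDd : D.degree = ((n + 1 : ℕ) : WithBot ℕ) := by
      rw [degree_eq_natDegree hDm.ne_zero, hDn]
    have hDeval : ∀ t : ℚ, D.eval t = BallRivoal.poch (t + 1) (n + 1) := fun t => by
      rw [hD, eval_pochPoly]
    set S : ℚ[X] := Q /ₘ D with hS
    set R : ℚ[X] := Q %ₘ D with hR
    have hQRS : Q = R + D * S := (modByMonic_add_div Q D).symm
    have hRdeg : R.degree < ((n + 1 : ℕ) : WithBot ℕ) := hDd ▸ degree_modByMonic_lt Q hDm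
    have hSdeg : S.degree < ((A * (n + 1) : ℕ) : WithBot ℕ) := by
      by_cases hS0 : S = 0
      · rw [hS0, degree_zero]; exact WithBot.bot_lt_coe _
      have hQ0 : Q ≠ 0 := by
        rintro rfl
        exact hS0 (by rw [hS, zero_divByMonic])
      have h1 : S.natDegree = Q.natDegree - (n + 1) := by rw [hS, natDegree_divByMonic Q hDm, hDn]
      have h2 : Q.natDegree < A * (n + 1) + (n + 1) := by
        have h := (natDegree_lt_iff_degree_lt hQ0).2 hQ
        rwa [add_one_mul] at h
      refine (natDegree_lt_iff_degree_lt hS0).1 ?_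
      rw [h1]
      have hM1 : n + 1 ≤ A * (n + 1) := Nat.le_mul_of_pos_left (n + 1) hA
      obtain ⟨M, hM⟩ : ∃ M, A * (n + 1) = M := ⟨_, rfl⟩
      rw [hM] at h2 hM1 ⊢
      omega
    obtain ⟨c₁, hc₁⟩ := ih S hSdeg
    have hfam : ∀ m : ℕ, ∃ c : ℕ → ℕ → ℚ, m ≤ n → ∀ t : ℚ, (∀ p, p ≤ n → t + p + 1 ≠ 0) →
        pfEval n (A + 1) c t = 1 / (t + m + 1) * (1 / BallRivoal.poch (t + 1) (n + 1)) ^ A := by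
      intro m
      by_cases hm : m ≤ n
      · obtain ⟨c, hc⟩ := exists_pf_pole_mul_pow n A m hm
        exact ⟨c, fun _ => hc⟩
      · exact ⟨fun _ _ => 0, fun h => absurd h hm⟩
    choose cf hcf using hfam
    set μ : ℕ → ℚ := fun m =>
      R.eval (-(m : ℚ) - 1) * ((-1) ^ m / ((m.factorial : ℚ) * (n - m).factorial)) with hμ
    refine ⟨(fun o p => if o < A then c₁ o p else 0) +
      ∑ m ∈ range (n + 1), (fun o p => μ m * cf m o p), fun t ht => ?_⟩
    have hpoch : BallRivoal.poch (t + 1) (n + 1) ≠ 0 := poch_succ_ne_zero n t ht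
    rw [pfEval_add, pfEval_sum, pfEval_extend, hc₁ t ht]
    have hsum : ∑ m ∈ range (n + 1), pfEval n (A + 1) (fun o p => μ m * cf m o p) t =
        (R.eval t / BallRivoal.poch (t + 1) (n + 1)) *
          (1 / BallRivoal.poch (t + 1) (n + 1)) ^ A := by
      rw [lagrange_div n R hRdeg t ht, sum_mul]
      refine sum_congr rfl fun m hm => ?_
      rw [pfEval_const_mul, hcf m (Nat.lt_succ_iff.1 (mem_range.1 hm)) t ht, hμ]
      ring
    rw [hsum, hQRS, eval_add, eval_mul, hDeval, one_div_pow, div_mul_div_comm, mul_one, ← pow_succ',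
      div_add_div _ _ (pow_ne_zero _ hpoch) (pow_ne_zero _ hpoch),
      div_eq_div_iff (mul_ne_zero (pow_ne_zero _ hpoch) (pow_ne_zero _ hpoch)) (pow_ne_zero _ hpoch)]
    ring

/-- `∑_p c_{0,p} = 0` when `deg Q ≤ A(n+1) - 2`: both `k·F(k) → ∑_p c_{0,p}` and `k·F(k) → 0` (degrees).
[cite: Rivoal2000CRAS, §2 proof of Lemme 1] -/
private theorem sum_c_zero (n A : ℕ) (hA : 1 ≤ A) (Q : ℚ[X]) (hQ : Q.natDegree + 2 ≤ A * (n + 1))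
    (c : ℕ → ℕ → ℚ)
    (hc : ∀ t : ℚ, (∀ p, p ≤ n → t + p + 1 ≠ 0) →
      pfEval n A c t = Q.eval t / BallRivoal.poch (t + 1) (n + 1) ^ A) :
    ∑ p ∈ range (n + 1), c 0 p = 0 := by
  have hlim1 := tendsto_mul_pfEval n A c
  have hval : ∑ p ∈ range (n + 1), ∑ o ∈ range A, (c o p : ℝ) * (0 : ℝ) ^ o =
      ((∑ p ∈ range (n + 1), c 0 p : ℚ) : ℝ) := by
    push_cast
    refine sum_congr rfl fun p _ => ?_
    obtain ⟨a', rfl⟩ : ∃ a', A = a' + 1 := ⟨A - 1, by omega⟩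
    rw [sum_range_succ']
    simp
  rw [hval] at hlim1
  set D : ℚ[X] := pochPoly 1 (n + 1) ^ A with hD
  have hDm : (pochPoly 1 (n + 1)).Monic := by
    rw [pochPoly]
    exact monic_prod_of_monic _ _ fun s _ => monic_X_add_C _
  have hDn : (pochPoly 1 (n + 1)).natDegree = n + 1 := by
    rw [pochPoly, natDegree_prod_of_monic _ _ fun s _ => monic_X_add_C _,
      Finset.sum_congr rfl fun s _ => natDegree_X_add_C _]
    simp
  have hDdeg : D.degree = ((A * (n + 1) : ℕ) : WithBot ℕ) := by
    rw [hD, degree_eq_natDegree (hDm.pow A).ne_zero, hDm.natDegree_pow, hDn]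
  have hNdeg : (X * Q).degree < D.degree := by
    rw [hDdeg]
    by_cases hQ0 : Q = 0
    · rw [hQ0, mul_zero, degree_zero]; exact WithBot.bot_lt_coe _
    · rw [degree_eq_natDegree (mul_ne_zero X_ne_zero hQ0), natDegree_X_mul hQ0]
      exact_mod_cast (by omega : Q.natDegree + 1 < A * (n + 1))
  have hlimQ : Tendsto (fun x : ℚ => (X * Q).eval x / D.eval x) atTop (𝓝 0) :=
    Polynomial.div_tendsto_atTop_zero_of_degree_lt _ _ hNdeg
  have hlimN : Tendsto (fun k : ℕ => (((X * Q).eval (k : ℚ) / D.eval (k : ℚ) : ℚ) : ℝ))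
      atTop (𝓝 0) := by
    have h := (Rat.continuous_coe_real.tendsto 0).comp (hlimQ.comp tendsto_natCast_atTop_atTop)
    rw [Rat.cast_zero] at h
    exact h
  have hlim2 : Tendsto (fun k : ℕ => (k : ℝ) * (pfEval n A c k : ℝ)) atTop (𝓝 0) := by
    refine hlimN.congr fun k => ?_
    have hpos : ∀ p, p ≤ n → (k : ℚ) + p + 1 ≠ 0 := fun p _ => by positivity
    rw [hc _ hpos, hD, eval_mul, eval_X, eval_pow, eval_pochPoly]
    push_cast
    ring
  have := tendsto_nhds_unique hlim1 hlim2
  exact_mod_cast this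

/-- The reflection `t ↦ -t-n-2` changes the sign of `P(t+1)/(t+1)_{n+1}^A` under the printed
symmetry hypothesis `P(-n-X) = (-1)^{A(n+1)+1} P(X)`. [cite: CressonFischlerRivoal2008, §1 (Théorème 1, hypothesis)] -/
private theorem F_reflect (n A : ℕ) (P : ℚ[X])
    (hsym : P.comp (-(n : ℚ[X]) - X) = (-1 : ℚ[X]) ^ (A * (n + 1) + 1) * P) (t : ℚ) :
    (P.comp (X + C 1)).eval (-t - n - 2) / BallRivoal.poch (-t - n - 2 + 1) (n + 1) ^ A =
      -((P.comp (X + C 1)).eval t / BallRivoal.poch (t + 1) (n + 1) ^ A) := by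
  have h1 : (P.comp (X + C 1)).eval (-t - n - 2) =
      (-1) ^ (A * (n + 1) + 1) * (P.comp (X + C 1)).eval t := by
    have h := congrArg (fun F : ℚ[X] => F.eval (t + 1)) hsym
    simp only [eval_comp, eval_sub, eval_neg, eval_natCast, eval_X, eval_mul, eval_pow, eval_one,
      eval_add, eval_C] at h ⊢
    rw [show -t - (n : ℚ) - 2 + 1 = -(n : ℚ) - (t + 1) by ring, h]
  have h2 : BallRivoal.poch (-t - n - 2 + 1) (n + 1) =
      (-1) ^ (n + 1) * BallRivoal.poch (t + 1) (n + 1) := by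
    have h := poch_reflect (t + 1) (n + 1)
    push_cast at h
    rw [show -t - (n : ℚ) - 2 + 1 = -(t + 1) - (n + 1) + 1 by ring, h]
  rw [h1, h2, mul_pow, ← pow_mul, pow_succ, mul_comm (n + 1) A, mul_assoc,
    mul_div_mul_left _ _ (pow_ne_zero _ (by norm_num : (-1 : ℚ) ≠ 0)), neg_one_mul, neg_div]

/-- The even zeta values drop out: `∑_p c_{o,p} = 0` for odd `o` (uniqueness of partial fractions applied to
`F(-t-n-2) + F(t) = 0`). [cite: Rivoal2000CRAS, §2 proof of Lemme 1] -/
private theorem sum_c_odd (n A : ℕ) (P : ℚ[X])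
    (hsym : P.comp (-(n : ℚ[X]) - X) = (-1 : ℚ[X]) ^ (A * (n + 1) + 1) * P)
    (c : ℕ → ℕ → ℚ)
    (hc : ∀ t : ℚ, (∀ p, p ≤ n → t + p + 1 ≠ 0) →
      pfEval n A c t = (P.comp (X + C 1)).eval t / BallRivoal.poch (t + 1) (n + 1) ^ A)
    (o : ℕ) (ho : o < A) (hodd : Odd o) : ∑ p ∈ range (n + 1), c o p = 0 := by
  set e : ℕ → ℕ → ℚ := (fun o p => (-1) ^ (o + 1) * c o (n - p)) + c with he
  have hev : ∀ t : ℕ, 0 ≤ t → pfEval n A e t = 0 := by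
    intro t _
    have h1 : ∀ m, m ≤ n → (t : ℚ) + m + 1 ≠ 0 := fun m _ => by positivity
    have h2 : ∀ m, m ≤ n → (-(t : ℚ) - n - 2) + m + 1 ≠ 0 := by
      intro m hm h0
      have : (m : ℚ) ≤ n := by exact_mod_cast hm
      have ht0 : (0 : ℚ) ≤ t := by positivity
      linarith
    rw [he, pfEval_add, pfEval_reflect, hc _ h2, hc _ h1, F_reflect n A P hsym]
    ring
  have hsymm : ∀ p, p ≤ n → c o (n - p) = -c o p := by
    intro p hp
    have h := pf_unique n A e 0 hev o p ho hp
    rw [he, Pi.add_apply, Pi.add_apply] at h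
    rw [hodd.add_one.neg_one_pow, one_mul] at h
    linarith
  have hrefl : ∑ p ∈ range (n + 1), c o p = ∑ p ∈ range (n + 1), c o (n - p) := by
    conv_lhs => rw [← sum_range_reflect]
    refine sum_congr rfl fun p _ => ?_
    simp
  have hneg : ∑ p ∈ range (n + 1), c o (n - p) = -∑ p ∈ range (n + 1), c o p := by
    rw [← sum_neg_distrib]
    exact sum_congr rfl fun p hp => hsymm p (Nat.lt_succ_iff.1 (mem_range.1 hp))
  linarith

/-- Summation of the partial-fraction expansion over `k ≥ 0` (the computation of Rivoal's Lemme 1 =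
`BallRivoal.hasSum_R`, for arbitrary data with `∑_p c_{0,p} = 0`). [cite: Rivoal2000CRAS, §2 Lemme 1] -/
private theorem hasSum_of_pf (n A : ℕ) (hA : 1 ≤ A) (c : ℕ → ℕ → ℚ) (F : ℚ → ℚ)
    (hc : ∀ t : ℚ, (∀ m, m ≤ n → t + m + 1 ≠ 0) → pfEval n A c t = F t)
    (hz : ∑ p ∈ range (n + 1), c 0 p = 0) :
    HasSum (fun k : ℕ => (F k : ℝ))
      (∑ o ∈ Ico 1 A, (∑ p ∈ range (n + 1), (c o p : ℝ)) * zetaValue (o + 1) -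
        ∑ o ∈ range A, ∑ p ∈ range (n + 1), (c o p : ℝ) * (harm (o + 1) p : ℝ)) := by
  have hpos : ∀ k : ℕ, ∀ m, m ≤ n → (k : ℚ) + m + 1 ≠ 0 := fun k m _ => by positivity
  have hexp : ∀ k : ℕ, (F k : ℝ) =
      ∑ o ∈ Ico 1 A, ∑ p ∈ range (n + 1), (c o p : ℝ) * (1 / ((k : ℝ) + p + 1) ^ (o + 1)) +
        ∑ p ∈ range (n + 1), (c 0 p : ℝ) * (-(1 / ((k : ℝ) + 1) - 1 / ((k : ℝ) + p + 1))) := by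
    intro k
    rw [← hc _ (hpos k), pfEval, sum_comm, range_eq_Ico, sum_eq_sum_Ico_succ_bot hA, add_comm]
    push_cast
    congr 1
    · refine sum_congr rfl fun o _ => sum_congr rfl fun p _ => ?_
      rw [div_eq_mul_one_div]
    · simp only [pow_one]
      have hz' : ∑ p ∈ range (n + 1), (c 0 p : ℝ) * (1 / ((k : ℝ) + 1)) = 0 := by
        rw [← sum_mul]
        have : ∑ p ∈ range (n + 1), (c 0 p : ℝ) = 0 := by exact_mod_cast hz
        rw [this, zero_mul]
      calc ∑ p ∈ range (n + 1), (c 0 p : ℝ) / ((k : ℝ) + p + 1)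
          = ∑ p ∈ range (n + 1), (c 0 p : ℝ) / ((k : ℝ) + p + 1) -
              ∑ p ∈ range (n + 1), (c 0 p : ℝ) * (1 / ((k : ℝ) + 1)) := by rw [hz', sub_zero]
        _ = _ := by
            rw [← sum_sub_distrib]
            exact sum_congr rfl fun p _ => by ring
  have hA' : ∀ o ∈ Ico 1 A, HasSum (fun k : ℕ => ∑ p ∈ range (n + 1),
      (c o p : ℝ) * (1 / ((k : ℝ) + p + 1) ^ (o + 1)))
      (∑ p ∈ range (n + 1), (c o p : ℝ) * (zetaValue (o + 1) - (harm (o + 1) p : ℝ))) := by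
    intro o ho
    have ho' : 2 ≤ o + 1 := by have := (mem_Ico.1 ho).1; omega
    exact hasSum_sum fun p _ => (hasSum_one_div_pow_shift (o + 1) p ho').mul_left _
  have hB : ∀ p ∈ range (n + 1), HasSum (fun k : ℕ =>
      (c 0 p : ℝ) * (-(1 / ((k : ℝ) + 1) - 1 / ((k : ℝ) + p + 1))))
      ((c 0 p : ℝ) * (-(harm 1 p : ℝ))) := by
    intro p _
    have h := ((hasSum_sub_shift p).mul_left (c 0 p : ℝ)).neg
    have e1 : (fun k : ℕ => (c 0 p : ℝ) * (-(1 / ((k : ℝ) + 1) - 1 / ((k : ℝ) + p + 1)))) =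
        fun k : ℕ => -((c 0 p : ℝ) * (1 / ((k : ℝ) + 1) - 1 / ((k : ℝ) + p + 1))) :=
      funext fun k => by ring
    rw [e1, show (c 0 p : ℝ) * (-(harm 1 p : ℝ)) = -((c 0 p : ℝ) * harm 1 p) by ring]
    exact h
  have hAB := (hasSum_sum hA').add (hasSum_sum hB)
  rw [show (fun k : ℕ => (F k : ℝ)) = fun k : ℕ =>
      ∑ o ∈ Ico 1 A, ∑ p ∈ range (n + 1), (c o p : ℝ) * (1 / ((k : ℝ) + p + 1) ^ (o + 1)) +
        ∑ p ∈ range (n + 1), (c 0 p : ℝ) * (-(1 / ((k : ℝ) + 1) - 1 / ((k : ℝ) + p + 1)))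
      from funext hexp]
  convert hAB using 1
  rw [range_eq_Ico A, sum_eq_sum_Ico_succ_bot hA]
  simp only [mul_sub, sum_sub_distrib, sum_mul, mul_neg, sum_neg_distrib, zero_add]
  ring

/-- **Théorème 1** of [CressonFischlerRivoal2008], PROVED (discharge of the named fact `theoreme1`),
by the argument the source cites ([BR], Rivoal 2000): partial fractions of `P(k)/(k)_{n+1}^A`, the
vanishing of the polar part at infinity (`deg P ≤ A(n+1)-2`), the reflection `k ↦ -n-k` which kills the
coefficients of the even zeta values, and summation over `k`.
[cite: CressonFischlerRivoal2008, Théorème 1] -/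
theorem theoreme1_holds : theoreme1 := by
  intro n A P hA hdeg hsym
  set Q : ℚ[X] := P.comp (X + C 1) with hQdef
  have hQnat : Q.natDegree = P.natDegree := by
    rw [hQdef, natDegree_comp, natDegree_X_add_C, mul_one]
  have hQdeg : Q.degree < ((A * (n + 1) : ℕ) : WithBot ℕ) :=
    degree_le_natDegree.trans_lt (by exact_mod_cast (by omega : Q.natDegree < A * (n + 1)))
  obtain ⟨c, hc⟩ := exists_pf n A hA Q hQdeg
  have hz : ∑ p ∈ range (n + 1), c 0 p = 0 := sum_c_zero n A hA Q (by omega) c hc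
  have hS := hasSum_of_pf n A hA c
    (fun t => Q.eval t / BallRivoal.poch (t + 1) (n + 1) ^ A) hc hz
  -- the summand of the fact is the cast of `Q(k)/(k+1)_{n+1}^A`
  have hev : ∀ k : ℕ, (Polynomial.aeval ((k : ℝ) + 1) P) = ((Q.eval (k : ℚ) : ℚ) : ℝ) := by
    intro k
    rw [hQdef, eval_comp, eval_add, eval_X, eval_C, ← eq_ratCast (algebraMap ℚ ℝ),
      ← aeval_algebraMap_apply_eq_algebraMap_eval, map_add, map_natCast, map_one]
  have hpc : ∀ k : ℕ, poch (k + 1) n = ((BallRivoal.poch ((k : ℚ) + 1) (n + 1) : ℚ) : ℝ) := by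
    intro k
    rw [poch, BallRivoal.poch]
    push_cast
    rfl
  have hfun : (fun k : ℕ => (Polynomial.aeval ((k : ℝ) + 1) P) / poch (k + 1) n ^ A) =
      fun k : ℕ => (((fun t : ℚ => Q.eval t / BallRivoal.poch (t + 1) (n + 1) ^ A) (k : ℚ) : ℚ) : ℝ) := by
    funext k
    simp only [Rat.cast_div, Rat.cast_pow, hev k, hpc k]
  -- the value: even orders vanish, reindex `s = o + 1`
  have hval : ∑ o ∈ Ico 1 A, (∑ p ∈ range (n + 1), (c o p : ℝ)) * zetaValue (o + 1) =
      ∑ s ∈ (Icc 3 A).filter Odd, (∑ p ∈ range (n + 1), (c (s - 1) p : ℝ)) * zetaValue s := by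
    have h1 : ∑ o ∈ Ico 1 A, (∑ p ∈ range (n + 1), (c o p : ℝ)) * zetaValue (o + 1) =
        ∑ s ∈ Ico 2 (A + 1), (∑ p ∈ range (n + 1), (c (s - 1) p : ℝ)) * zetaValue s := by
      rw [← sum_Ico_add' (fun s => (∑ p ∈ range (n + 1), (c (s - 1) p : ℝ)) * zetaValue s) 1 A 1]
      simp only [Nat.add_sub_cancel]
    have h2 : (Ico 2 (A + 1)).filter Odd = (Icc 3 A).filter Odd := by
      ext s
      simp only [mem_filter, mem_Ico, mem_Icc]
      constructor
      · rintro ⟨⟨h2, h3⟩, ho⟩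
        obtain ⟨m, hm⟩ := id ho
        exact ⟨⟨by omega, by omega⟩, ho⟩
      · rintro ⟨⟨h2, h3⟩, ho⟩
        exact ⟨⟨by omega, by omega⟩, ho⟩
    have h3 : ∑ s ∈ (Ico 2 (A + 1)).filter (fun s => ¬Odd s),
        (∑ p ∈ range (n + 1), (c (s - 1) p : ℝ)) * zetaValue s = 0 := by
      refine sum_eq_zero fun s hs => ?_
      obtain ⟨hs, hso⟩ := mem_filter.1 hs
      have hs' := mem_Ico.1 hs
      have hodd : Odd (s - 1) := by
        rcases Nat.even_or_odd s with he' | ho'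
        · obtain ⟨m, hm⟩ := he'
          exact ⟨m - 1, by omega⟩
        · exact absurd ho' hso
      have h0 : ∑ p ∈ range (n + 1), c (s - 1) p = 0 :=
        sum_c_odd n A P hsym c hc (s - 1) (by omega) hodd
      have h0' : ∑ p ∈ range (n + 1), (c (s - 1) p : ℝ) = 0 := by exact_mod_cast h0
      rw [h0', zero_mul]
    rw [h1, ← sum_filter_add_sum_filter_not (Ico 2 (A + 1)) Odd, h3, add_zero, h2]
  refine ⟨fun s => if s = 0 then -∑ o ∈ range A, ∑ p ∈ range (n + 1), c o p * harm (o + 1) p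
    else ∑ p ∈ range (n + 1), c (s - 1) p, ?_⟩
  rw [hfun]
  convert hS using 1
  rw [hval]
  beta_reduce
  rw [if_pos rfl]
  have h4 : ∑ s ∈ (Icc 3 A).filter Odd,
      (((if s = 0 then -∑ o ∈ range A, ∑ p ∈ range (n + 1), c o p * harm (o + 1) p
        else ∑ p ∈ range (n + 1), c (s - 1) p : ℚ) : ℝ)) * zetaValue s =
      ∑ s ∈ (Icc 3 A).filter Odd, (∑ p ∈ range (n + 1), (c (s - 1) p : ℝ)) * zetaValue s := by
    refine sum_congr rfl fun s hs => ?_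
    have hs3 : 3 ≤ s := (mem_Icc.1 (mem_filter.1 hs).1).1
    rw [if_neg (by omega)]
    push_cast
    rfl
  rw [h4]
  push_cast
  ring

variable {p : ℕ}

/-! ### Proof of Théorème 2: reduction to Théorème 1 -/

/-- The sign change `X_j ↦ -X_j` (other variables fixed). [folklore] -/
private def negVar (j : Fin p) : Fin p → MvPolynomial (Fin p) ℚ :=
  fun i => if i = j then -MvPolynomial.X i else MvPolynomial.X i

/-- `coeff_m (Q(…,-X_j,…)) = (-1)^{m_j} coeff_m Q`. [folklore] -/
private theorem coeff_aeval_negVar (j : Fin p) (Q : MvPolynomial (Fin p) ℚ) (m : Fin p →₀ ℕ) :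
    MvPolynomial.coeff m (MvPolynomial.aeval (negVar j) Q) =
      (-1) ^ (m j) * MvPolynomial.coeff m Q := by
  classical
  induction Q using MvPolynomial.induction_on' with
  | monomial u a =>
    rw [MvPolynomial.aeval_monomial, MvPolynomial.algebraMap_eq]
    have hprod : (u.prod fun i k => negVar j i ^ k) =
        MvPolynomial.C ((-1 : ℚ) ^ (u j)) * u.prod (fun i k => MvPolynomial.X i ^ k) := by
      unfold Finsupp.prod
      have h1 : ∀ i ∈ u.support, negVar j i ^ u i =
          MvPolynomial.C (if i = j then (-1 : ℚ) ^ u i else 1) * MvPolynomial.X i ^ u i := by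
        intro i _
        unfold negVar
        split_ifs with h
        · rw [neg_pow, map_pow, map_neg, map_one]
        · rw [map_one, one_mul]
      rw [Finset.prod_congr rfl h1, Finset.prod_mul_distrib, ← map_prod]
      congr 2
      rw [Finset.prod_ite_eq']
      split_ifs with hj
      · rfl
      · rw [Finsupp.mem_support_iff, not_not] at hj
        rw [hj, pow_zero]
    rw [hprod, ← mul_assoc, ← map_mul, ← MvPolynomial.monomial_eq, MvPolynomial.coeff_monomial,
      MvPolynomial.coeff_monomial]
    split_ifs with h
    · rw [h]; ring
    · ring
  | add p q hp hq => rw [map_add, MvPolynomial.coeff_add, MvPolynomial.coeff_add, hp, hq, mul_add]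

/-- A substitution `X_i ↦ X_i + c` does not increase partial degrees (stated for an explicit sum of
monomials). [folklore] -/
private theorem degreeOf_bind₁_sum_le (c : ℚ) (j : Fin p) (s : Finset (Fin p →₀ ℕ))
    (a : (Fin p →₀ ℕ) → ℚ) (D : ℕ) (hs : ∀ u ∈ s, u j ≤ D) :
    (MvPolynomial.bind₁ (fun i => MvPolynomial.X i + MvPolynomial.C c)
      (∑ v ∈ s, MvPolynomial.monomial v (a v))).degreeOf j ≤ D := by
  classical
  rw [map_sum]
  refine (MvPolynomial.degreeOf_sum_le _ _ _).trans (Finset.sup_le fun u hu => ?_)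
  rw [MvPolynomial.bind₁_monomial]
  refine (MvPolynomial.degreeOf_C_mul_le _ _ _).trans ?_
  refine (MvPolynomial.degreeOf_prod_le _ _ _).trans ?_
  have hXC : ∀ i, (MvPolynomial.X i + MvPolynomial.C c : MvPolynomial (Fin p) ℚ).degreeOf j ≤
      if j = i then 1 else 0 := by
    intro i
    refine (MvPolynomial.degreeOf_add_le _ _ _).trans ?_
    rw [MvPolynomial.degreeOf_X, MvPolynomial.degreeOf_C]
    exact max_le le_rfl (Nat.zero_le _)
  have h1 : ∀ i ∈ u.support, ((MvPolynomial.X i + MvPolynomial.C c) ^ u i).degreeOf j ≤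
      if j = i then u i else 0 := by
    intro i _
    refine (MvPolynomial.degreeOf_pow_le _ _ _).trans ?_
    refine (Nat.mul_le_mul_left _ (hXC i)).trans ?_
    split_ifs <;> simp
  refine (Finset.sum_le_sum h1).trans ?_
  rw [Finset.sum_ite_eq]
  split_ifs with hj
  · exact hs u hu
  · exact Nat.zero_le _

/-- An affine substitution `X_i ↦ X_i + c` does not increase partial degrees. [folklore] -/
private theorem degreeOf_bind₁_X_add_C_le (c : ℚ) (P : MvPolynomial (Fin p) ℚ) (j : Fin p) :
    (MvPolynomial.bind₁ (fun i => MvPolynomial.X i + MvPolynomial.C c) P).degreeOf j ≤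
      P.degreeOf j := by
  have h := degreeOf_bind₁_sum_le c j P.support (fun v => MvPolynomial.coeff v P) (P.degreeOf j)
    (fun u hu => MvPolynomial.monomial_le_degreeOf j hu)
  rwa [← P.as_sum] at h

/-- Products of absolutely convergent series over `ℕ^q`. [folklore] -/
private theorem hasSum_pi (q : ℕ) : ∀ (f : Fin q → ℕ → ℝ) (l : Fin q → ℝ),
    (∀ j, HasSum (f j) (l j)) → HasSum (fun k : Fin q → ℕ => ∏ j, f j (k j)) (∏ j, l j) := by
  induction q with
  | zero =>
    intro f l _
    simp only [Finset.univ_eq_empty, Finset.prod_empty]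
    exact hasSum_single (f := fun _ : Fin 0 → ℕ => (1 : ℝ)) default
      (fun b' hb' => (hb' (Subsingleton.elim _ _)).elim)
  | succ q ih =>
    intro f l h
    set g : (Fin q → ℕ) → ℝ := fun k => ∏ j : Fin q, f j.succ (k j) with hg
    set f₀ : ℕ → ℝ := f 0 with hf₀
    have h0 : HasSum f₀ (l 0) := h 0
    have ht : HasSum g (∏ j : Fin q, l j.succ) :=
      ih (fun j => f j.succ) (fun j => l j.succ) (fun j => h j.succ)
    have hs0 : Summable fun x => ‖f₀ x‖ := by
      simpa only [Real.norm_eq_abs] using h0.summable.abs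
    have hst : Summable fun k : Fin q → ℕ => ‖g k‖ := by
      simpa only [Real.norm_eq_abs] using ht.summable.abs
    have hfg : Summable fun x : ℕ × (Fin q → ℕ) => f₀ x.1 * g x.2 :=
      summable_mul_of_summable_norm hs0 hst
    have hm : HasSum (fun x : ℕ × (Fin q → ℕ) => f₀ x.1 * g x.2) (l 0 * ∏ j : Fin q, l j.succ) :=
      h0.mul ht hfg
    rw [Fin.prod_univ_succ]
    refine (Equiv.hasSum_iff (f := fun k : Fin (q + 1) → ℕ => ∏ j, f j (k j))
      (Fin.consEquiv fun _ : Fin (q + 1) => ℕ)).1 ?_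
    have hfun : ((fun k : Fin (q + 1) → ℕ => ∏ j, f j (k j)) ∘
        ⇑(Fin.consEquiv fun _ : Fin (q + 1) => ℕ)) = fun x : ℕ × (Fin q → ℕ) => f₀ x.1 * g x.2 := by
      funext x
      simp only [hg, hf₀, Function.comp_apply, Fin.consEquiv_apply, Fin.prod_univ_succ, Fin.cons_zero,
        Fin.cons_succ]
    rw [hfun]
    exact hm

/-- **Théorème 2** of [CressonFischlerRivoal2008], PROVED (discharge of the named fact `theoreme2`), by
reduction to Théorème 1: after the shift `X_j = Y_j - n/2` the symmetry becomes `Y_j ↦ -Y_j`, so `P` is a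
`ℚ`-combination of monomials `∏_j (X_j + n/2)^{m_j}` with `(-1)^{m_j} = (-1)^{A(n+1)+1}` and
`m_j ≤ A(n+1) - 2`; each factor `(X + n/2)^{m_j}` satisfies the hypotheses of Théorème 1, and the decoupled
sum is the corresponding combination of products of `p` linear forms in `1` and the odd `ζ(s)`.
[cite: CressonFischlerRivoal2008, Théorème 2] -/
theorem theoreme2_holds : theoreme2 := by
  intro p n A P hp hA hdeg hsym
  classical
  set c : ℚ := (n : ℚ) / 2 with hc
  set N : ℕ := A * (n + 1) + 1 with hN
  set sm : Fin p → MvPolynomial (Fin p) ℚ := fun i => MvPolynomial.X i - MvPolynomial.C c with hsm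
  set sp : Fin p → MvPolynomial (Fin p) ℚ := fun i => MvPolynomial.X i + MvPolynomial.C c with hsp
  set Q : MvPolynomial (Fin p) ℚ := MvPolynomial.bind₁ sm P with hQ
  have hnC : (n : MvPolynomial (Fin p) ℚ) = 2 * MvPolynomial.C c := by
    rw [← map_natCast MvPolynomial.C n, ← map_ofNat MvPolynomial.C 2, ← map_mul, hc]
    congr 1
    ring
  have hPQ : P = MvPolynomial.bind₁ sp Q := by
    rw [hQ, MvPolynomial.bind₁_bind₁]
    have : (fun i => MvPolynomial.bind₁ sp (sm i)) = MvPolynomial.X := by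
      funext i
      simp only [hsm, hsp, map_sub, MvPolynomial.bind₁_X_right, MvPolynomial.bind₁_C_right]
      ring
    rw [this, MvPolynomial.bind₁_X_left]
    rfl
  -- the symmetry of `Q` under `X_j ↦ -X_j`
  have hQsym : ∀ j, MvPolynomial.aeval (negVar j) Q = MvPolynomial.C ((-1 : ℚ) ^ N) * Q := by
    intro j
    have h3 : (fun i => MvPolynomial.bind₁ (negVar j) (sm i)) = fun i => MvPolynomial.bind₁ sm
        (if i = j then -(n : MvPolynomial (Fin p) ℚ) - MvPolynomial.X j else MvPolynomial.X i) := by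
      funext i
      by_cases h : i = j
      · subst h
        simp only [hsm, negVar, if_true, map_sub, map_neg, MvPolynomial.bind₁_X_right,
          MvPolynomial.bind₁_C_right, map_natCast]
        rw [hnC]
        ring
      · simp only [hsm, negVar, if_neg h, map_sub, MvPolynomial.bind₁_X_right, MvPolynomial.bind₁_C_right]
    calc MvPolynomial.aeval (negVar j) Q
        = MvPolynomial.bind₁ (negVar j) (MvPolynomial.bind₁ sm P) := rfl
      _ = MvPolynomial.bind₁ (fun i => MvPolynomial.bind₁ (negVar j) (sm i)) P :=
          MvPolynomial.bind₁_bind₁ _ _ _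
      _ = MvPolynomial.bind₁ (fun i => MvPolynomial.bind₁ sm
            (if i = j then -(n : MvPolynomial (Fin p) ℚ) - MvPolynomial.X j else MvPolynomial.X i)) P := by
          rw [h3]
      _ = MvPolynomial.bind₁ sm (MvPolynomial.bind₁
            (fun i => if i = j then -(n : MvPolynomial (Fin p) ℚ) - MvPolynomial.X j else MvPolynomial.X i) P) :=
          (MvPolynomial.bind₁_bind₁ _ _ _).symm
      _ = MvPolynomial.bind₁ sm ((-1 : MvPolynomial (Fin p) ℚ) ^ (A * (n + 1) + 1) * P) := by
          have := hsym j
          change MvPolynomial.bind₁ _ P = _ at this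
          rw [this]
      _ = MvPolynomial.C ((-1 : ℚ) ^ N) * Q := by
          rw [map_mul, map_pow, map_neg, map_one, hQ, hN, map_pow, map_neg, map_one]
  -- consequences for the monomials of `Q`
  have hsign : ∀ m ∈ Q.support, ∀ j, ((-1 : ℚ)) ^ (m j) = (-1) ^ N := by
    intro m hm j
    have h1 := coeff_aeval_negVar j Q m
    rw [hQsym j, MvPolynomial.coeff_C_mul] at h1
    exact (mul_right_cancel₀ (MvPolynomial.mem_support_iff.1 hm) h1).symm
  have hdegm : ∀ m ∈ Q.support, ∀ j, m j + 2 ≤ A * (n + 1) := by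
    intro m hm j
    have h1 : m j ≤ Q.degreeOf j := MvPolynomial.monomial_le_degreeOf j hm
    have h2 : Q.degreeOf j ≤ P.degreeOf j := by
      have e : (fun i : Fin p => MvPolynomial.X i + MvPolynomial.C (-c)) = sm := by
        funext i; simp [hsm, sub_eq_add_neg]
      have := degreeOf_bind₁_X_add_C_le (-c) P j
      rwa [e] at this
    have := hdeg j
    omega
  -- Théorème 1 for each univariate factor `(X + c)^{m_j}`
  have huni : ∀ (m : Fin p →₀ ℕ) (j : Fin p), ∃ a : ℕ → ℚ, m ∈ Q.support →
      HasSum (fun k : ℕ => (Polynomial.aeval ((k : ℝ) + 1) ((Polynomial.X + Polynomial.C c) ^ (m j))) /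
          poch (k + 1) n ^ A)
        ((a 0 : ℝ) + ∑ s ∈ (Finset.Icc 3 A).filter Odd, (a s : ℝ) * zetaValue s) := by
    intro m j
    by_cases hm : m ∈ Q.support
    · have hd : ((Polynomial.X + Polynomial.C c) ^ (m j)).natDegree + 2 ≤ A * (n + 1) := by
        rw [Polynomial.natDegree_pow, Polynomial.natDegree_X_add_C, mul_one]
        exact hdegm m hm j
      have hs : ((Polynomial.X + Polynomial.C c) ^ (m j)).comp (-(n : Polynomial ℚ) - Polynomial.X) =
          (-1 : Polynomial ℚ) ^ (A * (n + 1) + 1) * (Polynomial.X + Polynomial.C c) ^ (m j) := by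
        rw [Polynomial.pow_comp, Polynomial.add_comp, Polynomial.X_comp, Polynomial.C_comp]
        have e1 : (-(n : Polynomial ℚ) - Polynomial.X + Polynomial.C c) =
            -(Polynomial.X + Polynomial.C c) := by
          have : (n : Polynomial ℚ) = 2 * Polynomial.C c := by
            rw [← map_natCast Polynomial.C n, ← map_ofNat Polynomial.C 2, ← map_mul, hc]
            congr 1
            ring
          rw [this]
          ring
        have e2 : ((-1 : Polynomial ℚ)) ^ (m j) = (-1) ^ (A * (n + 1) + 1) := by
          have := congrArg Polynomial.C (hsign m hm j)
          simpa [hN] using this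
        rw [e1, neg_pow, e2]
      obtain ⟨a, ha⟩ := theoreme1_holds n A _ hA hd hs
      exact ⟨a, fun _ => ha⟩
    · exact ⟨fun _ => 0, fun h => absurd h hm⟩
  choose a ha using huni
  set S : Finset ℕ := (Finset.Icc 3 A).filter Odd with hS
  set ℓ : (Fin p →₀ ℕ) → Fin p → ℝ := fun m j =>
    (a m j 0 : ℝ) + ∑ s ∈ S, (a m j s : ℝ) * zetaValue s with hℓ
  set term : (Fin p →₀ ℕ) → Fin p → ℕ → ℝ := fun m j k =>
    (Polynomial.aeval ((k : ℝ) + 1) ((Polynomial.X + Polynomial.C c) ^ (m j))) / poch (k + 1) n ^ A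
    with hterm
  have hprod : ∀ m ∈ Q.support, HasSum (fun k : Fin p → ℕ => ∏ j, term m j (k j)) (∏ j, ℓ m j) :=
    fun m hm => hasSum_pi p (term m) (ℓ m) (fun j => ha m j hm)
  have htotal : HasSum (fun k : Fin p → ℕ =>
      ∑ m ∈ Q.support, ((MvPolynomial.coeff m Q : ℚ) : ℝ) * ∏ j, term m j (k j))
      (∑ m ∈ Q.support, ((MvPolynomial.coeff m Q : ℚ) : ℝ) * ∏ j, ℓ m j) :=
    hasSum_sum fun m hm => (hprod m hm).mul_left _
  -- the summand of the fact, pointwise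
  have hpt : ∀ k : Fin p → ℕ, (MvPolynomial.aeval (fun j => ((k j : ℝ) + 1)) P) / ∏ j, poch (k j + 1) n ^ A =
      ∑ m ∈ Q.support, ((MvPolynomial.coeff m Q : ℚ) : ℝ) * ∏ j, term m j (k j) := by
    intro k
    have h1 : MvPolynomial.aeval (fun j => ((k j : ℝ) + 1)) P =
        ∑ m ∈ Q.support, ((MvPolynomial.coeff m Q : ℚ) : ℝ) * ∏ j, (((k j : ℝ) + 1) + (c : ℝ)) ^ (m j) := by
      rw [hPQ, MvPolynomial.aeval_bind₁]
      have e : (fun i => MvPolynomial.aeval (fun j => ((k j : ℝ) + 1)) (sp i)) =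
          fun i => ((k i : ℝ) + 1) + (c : ℝ) := by
        funext i
        simp only [hsp, map_add, MvPolynomial.aeval_X, MvPolynomial.aeval_C, eq_ratCast]
      rw [e, MvPolynomial.aeval_eq_eval₂Hom, MvPolynomial.coe_eval₂Hom, MvPolynomial.eval₂_eq']
      simp only [eq_ratCast]
    have h2 : ∀ (m : Fin p →₀ ℕ) (j : Fin p), term m j (k j) =
        (((k j : ℝ) + 1) + (c : ℝ)) ^ (m j) / poch (k j + 1) n ^ A := by
      intro m j
      simp only [hterm, map_pow, map_add, Polynomial.aeval_X, Polynomial.aeval_C, eq_ratCast]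
    rw [h1, Finset.sum_div]
    refine Finset.sum_congr rfl fun m _ => ?_
    rw [mul_div_assoc, ← Finset.prod_div_distrib]
    simp only [h2]
  -- the polynomial `F`
  set L : (Fin p →₀ ℕ) → Fin p → MvPolynomial ℕ ℚ := fun m j =>
    MvPolynomial.C (a m j 0) + ∑ s ∈ S, MvPolynomial.C (a m j s) * MvPolynomial.X s with hL
  refine ⟨∑ m ∈ Q.support, MvPolynomial.C (MvPolynomial.coeff m Q) * ∏ j, L m j, ?_, ?_, ?_⟩
  · -- total degree ≤ p
    refine MvPolynomial.totalDegree_finsetSum_le fun m _ => ?_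
    refine (MvPolynomial.totalDegree_mul _ _).trans ?_
    rw [MvPolynomial.totalDegree_C, zero_add]
    refine (MvPolynomial.totalDegree_finsetProd _ _).trans ?_
    have h1 : ∀ j ∈ (Finset.univ : Finset (Fin p)), (L m j).totalDegree ≤ 1 := by
      intro j _
      refine (MvPolynomial.totalDegree_add _ _).trans (max_le ?_ ?_)
      · rw [MvPolynomial.totalDegree_C]; exact zero_le_one
      · refine MvPolynomial.totalDegree_finsetSum_le fun s _ => ?_
        refine (MvPolynomial.totalDegree_mul _ _).trans ?_
        rw [MvPolynomial.totalDegree_C, MvPolynomial.totalDegree_X, zero_add]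
    refine (Finset.sum_le_sum h1).trans ?_
    simp
  · -- variables: odd `s`, `3 ≤ s ≤ A`
    intro s hs
    obtain ⟨m, -, hm⟩ := Finset.mem_biUnion.1 (MvPolynomial.vars_sum_subset _ _ hs)
    rcases Finset.mem_union.1 (MvPolynomial.vars_mul _ _ hm) with h2 | h2
    · simp [MvPolynomial.vars_C] at h2
    obtain ⟨j, -, hj⟩ := Finset.mem_biUnion.1 (MvPolynomial.vars_prod _ h2)
    rcases Finset.mem_union.1 (MvPolynomial.vars_add_subset _ _ hj) with h4 | h4
    · simp [MvPolynomial.vars_C] at h4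
    obtain ⟨s', hs', h6⟩ := Finset.mem_biUnion.1 (MvPolynomial.vars_sum_subset _ _ h4)
    rcases Finset.mem_union.1 (MvPolynomial.vars_mul _ _ h6) with h7 | h7
    · simp [MvPolynomial.vars_C] at h7
    rw [MvPolynomial.vars_X, Finset.mem_singleton] at h7
    subst h7
    simp only [hS, Finset.mem_filter, Finset.mem_Icc] at hs'
    exact ⟨hs'.2, hs'.1.1, hs'.1.2⟩
  · -- the sum
    have hval : MvPolynomial.aeval (fun s : ℕ => zetaValue s)
        (∑ m ∈ Q.support, MvPolynomial.C (MvPolynomial.coeff m Q) * ∏ j, L m j) =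
        ∑ m ∈ Q.support, ((MvPolynomial.coeff m Q : ℚ) : ℝ) * ∏ j, ℓ m j := by
      rw [map_sum]
      refine Finset.sum_congr rfl fun m _ => ?_
      rw [map_mul, map_prod, MvPolynomial.aeval_C, eq_ratCast]
      congr 1
      refine Finset.prod_congr rfl fun j _ => ?_
      simp only [hL, hℓ, map_add, map_sum, map_mul, MvPolynomial.aeval_C, MvPolynomial.aeval_X, eq_ratCast]
    rw [hval, show (fun k : Fin p → ℕ =>
        (MvPolynomial.aeval (fun j => ((k j : ℝ) + 1)) P) / ∏ j, poch (k j + 1) n ^ A) =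
        fun k => ∑ m ∈ Q.support, ((MvPolynomial.coeff m Q : ℚ) : ℝ) * ∏ j, term m j (k j) from funext hpt]
    exact htotal

/-! ### Théorème 1 with the coefficients explicit (public partial-fraction interface)

The proof of Théorème 1 above (the argument of [BR] = Ball–Rivoal and Rivoal, C. R. Acad. Sci. 2000, §2,
Lemme 1, which [CressonFischlerRivoal2008, §1] cites for it) computes the value of the series from ANY
partial-fraction data `c = (c_{o,p})_{o<A, p≤n}` of `P(t+1)/(t+1)_{n+1}^A`:

  `Σ_{k≥1} P(k)/(k)_{n+1}^A = Σ_{3≤s≤A, s odd} (Σ_p c_{s−1,p}) ζ(s) − Σ_{o<A} Σ_p c_{o,p} H_p^{(o+1)}`,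

with `Σ_p c_{0,p} = 0` (no `H^{(1)}`-divergence) and `Σ_p c_{o,p} = 0` for odd `o` (no even zeta values). The four
statements below make this interface public (same proofs as the private steps above; requested by the cell
pub-zeta5, whose conjectures are stated over the canonical coefficients `Σ_p c_{4,p}`, `Σ_p c_{2,p}` of a
very-well-poised series — unique by `BallRivoal.pf_unique`). -/

/-- Existence of partial-fraction data: for `deg Q < A(n+1)` there are `c_{o,p}` (`o < A`, `p ≤ n`) with
`Q(t)/(t+1)_{n+1}^A = Σ_{p≤n} Σ_{o<A} c_{o,p}/(t+p+1)^{o+1}` away from the poles ("on décompose en éléments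
simples", the first step of the proof of Théorème 1 via [BR]).
[cite: CressonFischlerRivoal2008, §1, proof of Théorème 1 (via [BR]; Rivoal 2000 §2 Lemme 1)] -/
theorem exists_pf_data (n A : ℕ) (hA : 1 ≤ A) (Q : ℚ[X])
    (hQ : Q.degree < ((A * (n + 1) : ℕ) : WithBot ℕ)) :
    ∃ c : ℕ → ℕ → ℚ, ∀ t : ℚ, (∀ p, p ≤ n → t + p + 1 ≠ 0) →
      pfEval n A c t = Q.eval t / BallRivoal.poch (t + 1) (n + 1) ^ A :=
  exists_pf n A hA Q hQ

/-- The polar part at infinity vanishes: `Σ_p c_{0,p} = 0` for any partial-fraction data of `Q(t)/(t+1)_{n+1}^A`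
when `deg Q ≤ A(n+1) − 2`. [cite: CressonFischlerRivoal2008, §1, proof of Théorème 1 (via [BR]; Rivoal 2000 §2 Lemme 1)] -/
theorem sum_pf_data_zero (n A : ℕ) (hA : 1 ≤ A) (Q : ℚ[X]) (hQ : Q.natDegree + 2 ≤ A * (n + 1))
    (c : ℕ → ℕ → ℚ)
    (hc : ∀ t : ℚ, (∀ p, p ≤ n → t + p + 1 ≠ 0) →
      pfEval n A c t = Q.eval t / BallRivoal.poch (t + 1) (n + 1) ^ A) :
    ∑ p ∈ range (n + 1), c 0 p = 0 :=
  sum_c_zero n A hA Q hQ c hc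

/-- The even zeta values drop out: under the symmetry `P(−n−X) = (−1)^{A(n+1)+1} P(X)`, any partial-fraction
data `c` of `P(t+1)/(t+1)_{n+1}^A` has `Σ_p c_{o,p} = 0` for every odd `o < A`.
[cite: CressonFischlerRivoal2008, §1, proof of Théorème 1 (via [BR]; Rivoal 2000 §2 Lemme 1)] -/
theorem sum_pf_data_odd (n A : ℕ) (P : ℚ[X])
    (hsym : P.comp (-(n : ℚ[X]) - X) = (-1 : ℚ[X]) ^ (A * (n + 1) + 1) * P)
    (c : ℕ → ℕ → ℚ)
    (hc : ∀ t : ℚ, (∀ p, p ≤ n → t + p + 1 ≠ 0) →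
      pfEval n A c t = (P.comp (X + C 1)).eval t / BallRivoal.poch (t + 1) (n + 1) ^ A)
    (o : ℕ) (ho : o < A) (hodd : Odd o) : ∑ p ∈ range (n + 1), c o p = 0 :=
  sum_c_odd n A P hsym c hc o ho hodd

/-- **Théorème 1 with explicit coefficients**: under the hypotheses of Théorème 1, for ANY partial-fraction
data `c` of `P(t+1)/(t+1)_{n+1}^A`,
`Σ_{k≥1} P(k)/(k)_{n+1}^A = Σ_{3≤s≤A, s odd} (Σ_p c_{s−1,p}) ζ(s) − Σ_{o<A} Σ_p c_{o,p} H_p^{(o+1)}` (as a `HasSum`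
over `k − 1 ∈ ℕ`). [cite: CressonFischlerRivoal2008, Théorème 1 (proof, via [BR]; Rivoal 2000 §2 Lemme 1)] -/
theorem hasSum_of_pf_data (n A : ℕ) (P : ℚ[X]) (hA : 1 ≤ A) (hdeg : P.natDegree + 2 ≤ A * (n + 1))
    (hsym : P.comp (-(n : ℚ[X]) - X) = (-1 : ℚ[X]) ^ (A * (n + 1) + 1) * P) (c : ℕ → ℕ → ℚ)
    (hc : ∀ t : ℚ, (∀ p, p ≤ n → t + p + 1 ≠ 0) →
      pfEval n A c t = (P.comp (X + C 1)).eval t / BallRivoal.poch (t + 1) (n + 1) ^ A) :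
    HasSum (fun k : ℕ => (Polynomial.aeval ((k : ℝ) + 1) P) / poch (k + 1) n ^ A)
      (∑ s ∈ (Icc 3 A).filter Odd, (∑ p ∈ range (n + 1), (c (s - 1) p : ℝ)) * zetaValue s -
        ∑ o ∈ range A, ∑ p ∈ range (n + 1), (c o p : ℝ) * (harm (o + 1) p : ℝ)) := by
  set Q : ℚ[X] := P.comp (X + C 1) with hQdef
  have hQnat : Q.natDegree = P.natDegree := by
    rw [hQdef, natDegree_comp, natDegree_X_add_C, mul_one]
  have hz : ∑ p ∈ range (n + 1), c 0 p = 0 := sum_c_zero n A hA Q (by omega) c hc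
  have hS := hasSum_of_pf n A hA c
    (fun t => Q.eval t / BallRivoal.poch (t + 1) (n + 1) ^ A) hc hz
  have hev : ∀ k : ℕ, (Polynomial.aeval ((k : ℝ) + 1) P) = ((Q.eval (k : ℚ) : ℚ) : ℝ) := by
    intro k
    rw [hQdef, eval_comp, eval_add, eval_X, eval_C, ← eq_ratCast (algebraMap ℚ ℝ),
      ← aeval_algebraMap_apply_eq_algebraMap_eval, map_add, map_natCast, map_one]
  have hpc : ∀ k : ℕ, poch (k + 1) n = ((BallRivoal.poch ((k : ℚ) + 1) (n + 1) : ℚ) : ℝ) := by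
    intro k
    rw [poch, BallRivoal.poch]
    push_cast
    rfl
  have hfun : (fun k : ℕ => (Polynomial.aeval ((k : ℝ) + 1) P) / poch (k + 1) n ^ A) =
      fun k : ℕ => (((fun t : ℚ => Q.eval t / BallRivoal.poch (t + 1) (n + 1) ^ A) (k : ℚ) : ℚ) : ℝ) := by
    funext k
    simp only [Rat.cast_div, Rat.cast_pow, hev k, hpc k]
  have hval : ∑ o ∈ Ico 1 A, (∑ p ∈ range (n + 1), (c o p : ℝ)) * zetaValue (o + 1) =
      ∑ s ∈ (Icc 3 A).filter Odd, (∑ p ∈ range (n + 1), (c (s - 1) p : ℝ)) * zetaValue s := by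
    have h1 : ∑ o ∈ Ico 1 A, (∑ p ∈ range (n + 1), (c o p : ℝ)) * zetaValue (o + 1) =
        ∑ s ∈ Ico 2 (A + 1), (∑ p ∈ range (n + 1), (c (s - 1) p : ℝ)) * zetaValue s := by
      rw [← sum_Ico_add' (fun s => (∑ p ∈ range (n + 1), (c (s - 1) p : ℝ)) * zetaValue s) 1 A 1]
      simp only [Nat.add_sub_cancel]
    have h2 : (Ico 2 (A + 1)).filter Odd = (Icc 3 A).filter Odd := by
      ext s
      simp only [mem_filter, mem_Ico, mem_Icc]
      constructor
      · rintro ⟨⟨h2, h3⟩, ho⟩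
        obtain ⟨m, hm⟩ := id ho
        exact ⟨⟨by omega, by omega⟩, ho⟩
      · rintro ⟨⟨h2, h3⟩, ho⟩
        exact ⟨⟨by omega, by omega⟩, ho⟩
    have h3 : ∑ s ∈ (Ico 2 (A + 1)).filter (fun s => ¬Odd s),
        (∑ p ∈ range (n + 1), (c (s - 1) p : ℝ)) * zetaValue s = 0 := by
      refine sum_eq_zero fun s hs => ?_
      obtain ⟨hs, hso⟩ := mem_filter.1 hs
      have hs' := mem_Ico.1 hs
      have hodd : Odd (s - 1) := by
        rcases Nat.even_or_odd s with he' | ho'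
        · obtain ⟨m, hm⟩ := he'
          exact ⟨m - 1, by omega⟩
        · exact absurd ho' hso
      have h0 : ∑ p ∈ range (n + 1), c (s - 1) p = 0 :=
        sum_c_odd n A P hsym c hc (s - 1) (by omega) hodd
      have h0' : ∑ p ∈ range (n + 1), (c (s - 1) p : ℝ) = 0 := by exact_mod_cast h0
      rw [h0', zero_mul]
    rw [h1, ← sum_filter_add_sum_filter_not (Ico 2 (A + 1)) Odd, h3, add_zero, h2]
  rw [hfun]
  convert hS using 1
  rw [hval]

/-! ### Public API: the partial-fraction expansion of `P(k)/(k)_{n+1}^A` and its summation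

(Restored: these four statements were landed by the cell's literature seat as p197629 and inadvertently dropped by the
concurrent whole-file append p198009 of the block above; both blocks expose the same private steps. Requested by the
cell's typer for the `ζ(5)/ζ(3)/1`-coefficients `U, W, V` of Brown–Zudilin's `F̃₇(b)`: with THE data `c` below —
unique by `BallRivoal.pf_unique` — those are `∑_p c 4 p`, `∑_p c 2 p` and `-∑_{o,p} c o p · H_p^{(o+1)}`.) The
statements are the "développement en éléments simples" of [CressonFischlerRivoal2008, §4.1 eq. (4.1)] in depth 1
and the two facts about it used in §4.4 there. -/

/-- **Partial fractions** of `Q(t)/(t+1)_{n+1}^A` for `deg Q < A(n+1)`: there are rationals `c_{o,p}`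
(`o < A`, `p ≤ n`) with `Q(t)/(t+1)_{n+1}^A = ∑_{p ≤ n} ∑_{o < A} c_{o,p}/(t+p+1)^{o+1}` away from the poles
(`BallRivoal.pfEval`; unique by `BallRivoal.pf_unique`). In the source's variable `k = t+1`:
`R(k) = P(k)/(k)_{n+1}^A = ∑_{j,s} c_{j,s}/(k+j)^s`. [cite: CressonFischlerRivoal2008, §4.1 (développement en éléments simples)] -/
theorem exists_partialFractions (n A : ℕ) (hA : 1 ≤ A) (Q : ℚ[X])
    (hQ : Q.degree < ((A * (n + 1) : ℕ) : WithBot ℕ)) :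
    ∃ c : ℕ → ℕ → ℚ, ∀ t : ℚ, (∀ p, p ≤ n → t + p + 1 ≠ 0) →
      pfEval n A c t = Q.eval t / BallRivoal.poch (t + 1) (n + 1) ^ A :=
  exists_pf n A hA Q hQ

/-- **The polar part at infinity vanishes**: if `deg Q ≤ A(n+1) - 2` then `∑_p c_{0,p} = 0` for the
partial-fraction data of `Q(t)/(t+1)_{n+1}^A` ("`k₁R → 0` … par unicité du développement en éléments
simples"). [cite: CressonFischlerRivoal2008, §4.4 (first display)] -/
theorem partialFractions_sum_order_zero (n A : ℕ) (hA : 1 ≤ A) (Q : ℚ[X])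
    (hQ : Q.natDegree + 2 ≤ A * (n + 1)) (c : ℕ → ℕ → ℚ)
    (hc : ∀ t : ℚ, (∀ p, p ≤ n → t + p + 1 ≠ 0) →
      pfEval n A c t = Q.eval t / BallRivoal.poch (t + 1) (n + 1) ^ A) :
    ∑ p ∈ range (n + 1), c 0 p = 0 :=
  sum_c_zero n A hA Q hQ c hc

/-- **The reflection kills the even zeta values**: under `P(-n-X) = (-1)^{A(n+1)+1}P(X)` the data of
`P(t+1)/(t+1)_{n+1}^A` satisfy `∑_p c_{o,p} = 0` for every odd `o < A` (the coefficient of `ζ(o+1)`).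
[cite: CressonFischlerRivoal2008, Théorème 1 (proof, §4.4) ; Rivoal2000CRAS, §2 proof of Lemme 1] -/
theorem partialFractions_sum_odd_order (n A : ℕ) (P : ℚ[X])
    (hsym : P.comp (-(n : ℚ[X]) - X) = (-1 : ℚ[X]) ^ (A * (n + 1) + 1) * P)
    (c : ℕ → ℕ → ℚ)
    (hc : ∀ t : ℚ, (∀ p, p ≤ n → t + p + 1 ≠ 0) →
      pfEval n A c t = (P.comp (X + C 1)).eval t / BallRivoal.poch (t + 1) (n + 1) ^ A)
    (o : ℕ) (ho : o < A) (hodd : Odd o) : ∑ p ∈ range (n + 1), c o p = 0 :=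
  sum_c_odd n A P hsym c hc o ho hodd

/-- **Summation of the expansion**: for partial-fraction data `c` of `F` with `∑_p c_{0,p} = 0`,
`∑_{k ≥ 0} F(k) = ∑_{1 ≤ o < A} (∑_p c_{o,p}) ζ(o+1) - ∑_{o < A} ∑_p c_{o,p} H_p^{(o+1)}`
(`H_p^{(i)} = BallRivoal.harm i p`). [cite: CressonFischlerRivoal2008, §4.4 ; Rivoal2000CRAS, §2 Lemme 1] -/
theorem hasSum_partialFractions (n A : ℕ) (hA : 1 ≤ A) (c : ℕ → ℕ → ℚ) (F : ℚ → ℚ)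
    (hc : ∀ t : ℚ, (∀ m, m ≤ n → t + m + 1 ≠ 0) → pfEval n A c t = F t)
    (hz : ∑ p ∈ range (n + 1), c 0 p = 0) :
    HasSum (fun k : ℕ => (F k : ℝ))
      (∑ o ∈ Ico 1 A, (∑ p ∈ range (n + 1), (c o p : ℝ)) * zetaValue (o + 1) -
        ∑ o ∈ range A, ∑ p ∈ range (n + 1), (c o p : ℝ) * (harm (o + 1) p : ℝ)) :=
  hasSum_of_pf n A hA c F hc hz

end Literature.NumberTheory.Irrationality.CressonFischlerRivoal2008
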